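/-
Copyright (c) 2026 the pub-hodgecm-mathlib formalisation cell (harness21).  Prover seat hodgecm-mathlib-F0P3a-p01 (g39), lane A (Unr-K, type U) of the (β₂) road, squad
F0∕P3a ∕ F0∕P3c∕LH4; β₂ WORD #42 leaf ‹LINE-L-A-MIX-HI›: LH7-p09 (g3)'s ★ p864441 `…LowerLineVertexReads.valueSet_eq_xPlus_iff_sphereSign_of_line` RE-ISSUED ON TYPE U with
`g2 ↦ g2b, g2c` (through (M2) `…LowerLineVertexRayA`); helper lane on h413 = stmt-HodgeConjecture-24833 (count-neutral).  2026-09-05.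
-/
import Summits.HodgeConjecture.HodgeConjecture.Theorems.F0P3cDyRamLowerLineVertexReads        -- ★ p864441 (LH7-p09 (g3)): the lane-B reads (`sphere_of_line` is lane-free and reused by name); brings ★ p863761
import Summits.HodgeConjecture.HodgeConjecture.Theorems.F0P3cDyRamLowerLineVertexRayA         -- (this seat, M2): `exists_fixed_unit_valueSet_eq_smul_xPlus_of_line_sizes_A`; brings (M1), ★ p863440 `v_rayScalar_eq_of_line`
import Summits.HodgeConjecture.HodgeConjecture.Theorems.F0P3cDyRamUpperLineCellCentre         -- ★ p864286 (LH4-p19 (g3), F3): `trace_div_cellScalar_eq_root` (the ray scalar in ROOT form, any lane)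
import Summits.HodgeConjecture.HodgeConjecture.Theorems.F0P3cDyRamRootRegimeAffineLabel       -- ★ p864285 (LH4-p19 (g3), F2): `normSign_eq_mul_of_rootRegime`, `v_mul_eq_of_v_sub_lt`, `v_centre_iff_of_lt`
import Summits.HodgeConjecture.HodgeConjecture.Theorems.F0P3cDyRamDiagonalCellLetter          -- ★ (LH4-p19): `inv_add_map_inv_eq_map_pairing` (the glue letter `D₀⁻¹ + ρD₀⁻¹ = jE⟨w₀,w₀⟩`)
import Summits.HodgeConjecture.HodgeConjecture.Theorems.F0P3cDyRamSmulXPlusLabel               -- ★ (LH4-p13): `labelPlus_smul_xPlus_iff_exists_norm`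
import Literature.NumberTheory.LocalFields.ValuedCompleteIsAdicComplete                       -- ★ BRIDGE-AC: `isAdicComplete_valuedInteger_of_completeSpace`
import HarnessLib

/-!
# Crux `H413`, line LH4 «(D-RAM) FOUR-FRAME» — STAGE-1b, row (2) of `f_{T₊}`, the (β₂) road (R-36), (OFF) residue, THE LOWER LINE, LANE A (Unr-K, type U): «THE LABEL READ OF
# A LOWER-LINE VERTEX WITHOUT `|Θα − α|`» — ★ p864441 §2 HEAD `valueSet_eq_xPlus_iff_sphereSign_of_line` with the size `g2` REPLACED by `g2b`, `g2c` and the type-U letters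
# `|α − ρα| = 1`, `|ρα − Θα| < 1`, `|2|_E < 1` (★ §1 `sphere_of_line` is lane-free and is reused BY NAME from ★ p864441)

Cell `hodgecm-mathlib` (D-0151), FLOOR 0, crux item H413 = `stmt-HodgeConjecture-24833`, route of record `HCCMUnconditional`; squads F0∕P3a ∕ F0∕P3c∕LH4 ∕ LH7; lane
`--supports stmt-HodgeConjecture-24833 --as helper` (count-neutral; pays NO tier-0 row).  THEOREMS ONLY (no `def`, no instance, no notation, no `sorry`, default heartbeats);
★-only imports; states NO law; (β₂) stays a HYPOTHESIS.  Frame = ★ p864441 §2's VERBATIM (junction datum, block `(H₂, h)`, the line model, glued vertex presented on `x₀`, the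
LOWER-LINE letters `hYb hcb hμle hanti`, the sizes `g1 g3 gsk`, `hΘlam hvlam huu`, deep tokens `hlamn hun`, `E` complete with finite residue field, the ROOT-REGIME tail
`hμρ hκ hWc hBE P γ₁ W₁` with the SLOPE and ROOT letters) EXCEPT `g2 ↦ g2b : |μ|·|cc| ≤ |ϖE|^{2b}·|ϖE|^{m⋆}, g2c : |μ − ρμ| ≤ |α − ρα|·|ϖE|^b·|ϖE|^{m⋆}` and the added binders
`hU hτ h2v` (after `g2c`).  Conclusion = ★'s VERBATIM.

WHY (LANE-A-BOARD v5 §3(b); (M1) `…NormFormRayOfTraceA`, (M2) `…LowerLineVertexRayA`).  ★ p864441 §2 reads the label through ★ p863761's fixed-unit ray `e′`; the only lane-B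
input on that road is FILE 12's `g2`, replaced in lane A by `g2b`, `g2c` (M1's `h2′` letter via the `Fix(Θρ)`-generator).  The proof is ★'s token for token with the one call
(M2) `exists_fixed_unit_valueSet_eq_smul_xPlus_of_line_sizes_A` for ★ p863761.
* HEAD `valueSet_eq_xPlus_iff_sphereSign_of_line_A` — `VS_{m⋆}(Γ − 1 ∣ L) = valueSetMod σ ϖ m⋆ X₊ ↔ normSign σ (⟨w₀,w₀⟩·P)·normSign σ (γ₁(V − W₁)) = 1`.
WHAT IS NOT CLAIMED: the cell-level SLOPE∕ROOT letters, the population read, the digit set of the cell, any count.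
HONEST LABEL.  Count-neutral valuation ∕ lattice algebra; nothing printed is asserted; no census law is stated; ‹LINE-L-A-MIX-HI› stays OPEN; `HC_CM` is proved only modulo
the 7 printed citations (2 remaining named inputs: hLiu418 = `stmt-HodgeConjecture-24832`, h413 = `stmt-HodgeConjecture-24833`) until rung 0 closes.
## References
* [Jacobowitz1962] R. Jacobowitz, *Hermitian forms over local fields*, Amer. J. Math. 84 (1962): §4 (duals, gluing).
* [Kottwitz1986BaseChangeUnits] R. E. Kottwitz, *Base change for unit elements of Hecke algebras*, Compositio Math. 60 (1986): §1 pp. 240–241, §3.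
* [Rogawski1990] J. D. Rogawski, *Automorphic Representations of Unitary Groups in Three Variables*, Ann. of Math. Stud. 123 (1990): §4.9 Prop. 4.9.1 (b) p. 55, §12.2.
* [Serre1979] J.-P. Serre, *Local Fields*, GTM 67 (1979): Ch. III §6 Prop. 12, Ch. V §3 Cor. 3, Ch. XV §2; [LanglandsShelstad1987] R. P. Langlands, D. Shelstad, Math. Ann. 278 (1987): §1–§3.
-/

set_option autoImplicit false

noncomputable section

namespace Summit.HodgeConjecture.HodgeConjecture.Cruxes.H413.F0P3cDyRamLowerLineVertexReadsA

open scoped Valued WithZero Matrix MatrixGroups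
open WithZero
open Literature.NumberTheory.Automorphic Literature.NumberTheory.Automorphic.HermitianLattice Literature.NumberTheory.Automorphic.UnitaryLatticeTree
open Literature.NumberTheory.Automorphic.UnitaryThreeFourFrame (IsRamifiedQuadraticDatum normSign)
open Literature.NumberTheory.Rogawski1990
open Literature.NumberTheory.LocalFields (isAdicComplete_valuedInteger_of_completeSpace)
open Summit.HodgeConjecture.HodgeConjecture.Cruxes.H413.F0P3cDyRamFourFramePieces
open Summit.HodgeConjecture.HodgeConjecture.Cruxes.H413.F0P3cDyRamToricCensusDefs
open Summit.HodgeConjecture.HodgeConjecture.Cruxes.H413.F0P3cDyRamLabelShellFlipCardTwo (v_refSkew_eq)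
open Summit.HodgeConjecture.HodgeConjecture.Cruxes.H413.F0P3cDyRamSmulXPlusLabel (labelPlus_smul_xPlus_iff_exists_norm)
open Summit.HodgeConjecture.HodgeConjecture.Cruxes.H413.F0P3cDyRamDiagonalCellLetter (inv_add_map_inv_eq_map_pairing)
open Summit.HodgeConjecture.HodgeConjecture.Cruxes.H413.F0P3cDyRamRootRegimeAffineLabel (v_mul_eq_of_v_sub_lt v_centre_iff_of_lt normSign_eq_mul_of_rootRegime)
open Summit.HodgeConjecture.HodgeConjecture.Cruxes.H413.F0P3cDyRamUpperLineCellCentre (trace_div_cellScalar_eq_root)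
open Summit.HodgeConjecture.HodgeConjecture.Cruxes.H413.F0P3cDyRamLowerLineRayLetters (v_rayScalar_eq_of_line)
open Summit.HodgeConjecture.HodgeConjecture.Cruxes.H413.F0P3cDyRamLowerLineVertexRayA (exists_fixed_unit_valueSet_eq_smul_xPlus_of_line_sizes_A)
open Summit.HodgeConjecture.HodgeConjecture.Cruxes.H413.F0P3cDyRamLowerLineVertexReads (sphere_of_line)

variable {E M : Type} [Field E] [Valued E ℤᵐ⁰] [Field M] [Valued M ℤᵐ⁰] {ρ Θ : M →+* M} {α : M}

/-! ## §1 Every glued lower-line vertex is on the sphere digit -/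

/-- **HEAD — «THE LABEL OF A LOWER-LINE VERTEX IS THE SIGN `ω(⟨w₀,w₀⟩·P)·ω(γ₁(V − W₁))`».**  ★ p863761's HEAD frame VERBATIM (`hD H₂ h jE hjv hjiso hjfix hρρ hvρ hα hα1 hΘΘ hΘρ hvΘ hΘj
φ hφs hφγ hhM hΘh hform hpr hint hB hg₀ hg₀1 hprg u hc hc0 hc1 hcc hx₀ hBΛ hΛx hw₀Y hYO hYb hcb hμle hanti g1 g2b g2c hU hτ h2v g3 hn gsk hΘlam hvlam huu hlamn hun` (lane A: `g2 ↦ g2b g2c` + type-U letters), `E` complete with finite residue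
field) WITHOUT `he₀`, plus the root-regime tail in LH4-p19 (g3)'s R1a spelling (`hμρ hκ hWc hBE hP0 hσP hσpw hpwP hσγ hσW₁ hσV` and the SLOPE `|BE∕(P·t₊) − γ₁| ≤ |γ₁|·|ϖ|^{2d−1}`,
ROOT `|γ₁(W − W₁)| ≤ |ϖ|^{2d−1}` letters) — and NO sphere hypothesis (§1 supplies it).  THEN
`VS_{m⋆}(Γ − 1 ∣ L) = valueSetMod σ ϖ m⋆ (X₊) ↔ normSign σ (⟨w₀,w₀⟩·P)·normSign σ (γ₁(V − W₁)) = 1` — the lower-line `ψ` read of the count sockets, BOTH bands.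
[cite: Rogawski1990, §4.9 Prop. 4.9.1 (b) p. 55] [cite: Kottwitz1986BaseChangeUnits, §1 pp. 240–241] [cite: Jacobowitz1962, §4] [cite: Serre1979, Ch. V §3 Cor. 3; Ch. XV §2] [cite: LanglandsShelstad1987, §1–§3] -/
theorem valueSet_eq_xPlus_iff_sphereSign_of_line_A [CompleteSpace E] [Finite 𝓀[E]] {σ : E →+* E} {ϖ : E} {d t : ℕ} (hD : IsRamifiedQuadraticDatum σ ϖ d t)
    (H₂ : Matrix (Fin 2) (Fin 2) E) (h : E)
    (jE : E →+* M) (hjv : ∀ c, Valued.v (jE c) ≤ 1 ↔ Valued.v c ≤ 1) (hjiso : ∀ c, Valued.v (jE c) = Valued.v c) (hjfix : ∀ z, ρ z = z ↔ ∃ c, jE c = z)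
    (hρρ : ∀ x, ρ (ρ x) = x) (hvρ : ∀ x, Valued.v (ρ x) = Valued.v x) (hα : ρ α ≠ α) (hα1 : Valued.v α ≤ 1)
    (hΘΘ : ∀ x, Θ (Θ x) = x) (hΘρ : ∀ x, Θ (ρ x) = ρ (Θ x)) (hvΘ : ∀ x, Valued.v (Θ x) = Valued.v x) (hΘj : ∀ c, Θ (jE c) = jE (σ c))
    (φ : (Fin 2 → E) →+ M) (hφs : ∀ (c : E) (x : Fin 2 → E), φ (c • x) = jE c * φ x)
    {γ₂ : GL (Fin 2) E} {lam hM : M} (hφγ : ∀ x, φ ((γ₂ : Matrix (Fin 2) (Fin 2) E) *ᵥ x) = lam * φ x) (hhM : hM ≠ 0) (hΘh : Θ hM = hM)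
    (hform : ∀ x y, jE (pairing σ H₂ x y) = hM * Θ (φ x) * φ y + ρ (hM * Θ (φ x) * φ y))
    {L : Submodule 𝒪[E] (Fin 3 → E)} {b : ℕ} (hpr : ∀ x ∈ L, Valued.v (x 1) * Valued.v ϖ ^ b ≤ 1)
    (hint : ∀ y ∈ L, Valued.v (pairing σ (!![H₂ 0 0, 0, H₂ 0 1; 0, h, 0; H₂ 1 0, 0, H₂ 1 1] : Matrix (Fin 3) (Fin 3) E) y y) ≤ 1)
    {B₂ : Submodule 𝒪[E] (Fin 2 → E)} {w₀ : Fin 2 → E} {g₀ : Fin 3 → E}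
    (hB : B₂.map ((Matrix.toLin' (!![1, 0; 0, 0; 0, 1] : Matrix (Fin 3) (Fin 2) E)).restrictScalars 𝒪[E]) =
      L ⊓ LinearMap.ker ((LinearMap.proj (1 : Fin 3) : (Fin 3 → E) →ₗ[E] E).restrictScalars 𝒪[E]))
    (hg₀ : g₀ ∈ L) (hg₀1 : Valued.v (g₀ 1) * Valued.v ϖ ^ b = 1) (hprg : g₀ - Pi.single 1 (g₀ 1) = ![w₀ 0, 0, w₀ 1])
    (u : GL (Fin 1) E)
    {cc x₀ : M} (hc : ρ cc = cc) (hc0 : cc ≠ 0) (hc1 : Valued.v cc ≤ 1) (hcc : cc * (α - ρ α) ≠ 0) (hx₀ : x₀ ≠ 0)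
    {Λ : AddSubgroup M} (hBΛ : B₂.toAddSubgroup.map φ = Λ)
    (hΛx : ∀ x, x ∈ Λ ↔ ∃ ζ, IsOrd ρ α cc ζ ∧ x = x₀ * ζ) (hw₀Y : φ w₀ = (dualGen ρ Θ α cc hM x₀)⁻¹ * x₀)
    (hYO : IsOrd ρ α cc (dualGen ρ Θ α cc hM x₀))
    -- the LOWER-LINE letters (cell currency)
    (hYb : Valued.v (dualGen ρ Θ α cc hM x₀) = Valued.v (jE ϖ) ^ b) (hcb : Valued.v cc < Valued.v (jE ϖ) ^ b)
    (hμle : Valued.v (lam - jE ((u : Matrix (Fin 1) (Fin 1) E) 0 0)) ≤ Valued.v (jE ϖ) ^ (2 * b + d % 2 + 1))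
    (hanti : Valued.v ((lam - jE ((u : Matrix (Fin 1) (Fin 1) E) 0 0)) - ρ (lam - jE ((u : Matrix (Fin 1) (Fin 1) E) 0 0))) =
      Valued.v (cc * (α - ρ α)) * Valued.v (jE ϖ) ^ (b + d % 2))
    -- the ray-by-trace sizes at `m*` and the skew size at `n`
    (g1 : Valued.v (lam - jE ((u : Matrix (Fin 1) (Fin 1) E) 0 0)) * Valued.v (jE ϖ) ^ (d - 1) ≤
      Valued.v (α - ρ α) * Valued.v (jE ϖ) ^ b * Valued.v (jE ϖ) ^ mstarOfRecord d)
    (g2b : Valued.v (lam - jE ((u : Matrix (Fin 1) (Fin 1) E) 0 0)) * Valued.v cc ≤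
      Valued.v (jE ϖ) ^ b * Valued.v (jE ϖ) ^ b * Valued.v (jE ϖ) ^ mstarOfRecord d)
    (g2c : Valued.v ((lam - jE ((u : Matrix (Fin 1) (Fin 1) E) 0 0)) - ρ (lam - jE ((u : Matrix (Fin 1) (Fin 1) E) 0 0))) ≤
      Valued.v (α - ρ α) * Valued.v (jE ϖ) ^ b * Valued.v (jE ϖ) ^ mstarOfRecord d)
    (hU : Valued.v (α - ρ α) = 1) (hτ : Valued.v (ρ α - Θ α) < 1) (h2v : Valued.v (2 : E) < 1)
    (g3 : Valued.v (lam - jE ((u : Matrix (Fin 1) (Fin 1) E) 0 0)) * Valued.v cc ≤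
      Valued.v (α - ρ α) * Valued.v (jE ϖ) ^ b * Valued.v (jE ϖ) ^ mstarOfRecord d)
    {n : ℕ} (hn : 3 * d - 2 + d % 2 ≤ n)
    (gsk : Valued.v (lam - jE ((u : Matrix (Fin 1) (Fin 1) E) 0 0)) * Valued.v ((lam - jE ((u : Matrix (Fin 1) (Fin 1) E) 0 0)) - ρ (lam - jE ((u : Matrix (Fin 1) (Fin 1) E) 0 0))) ≤
      Valued.v (jE ϖ) ^ n * Valued.v (cc * (α - ρ α)) * Valued.v (jE ϖ) ^ b)
    -- the line-model structure, the deep tokens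
    (hΘlam : Θ lam * lam = 1) (hvlam : Valued.v lam = 1)
    (huu : ((u : Matrix (Fin 1) (Fin 1) E) 0 0) * σ ((u : Matrix (Fin 1) (Fin 1) E) 0 0) = 1)
    (hlamn : Valued.v (lam - 1) ≤ Valued.v (jE ϖ) ^ n) (hun : Valued.v ((u : Matrix (Fin 1) (Fin 1) E) 0 0 - 1) ≤ Valued.v ϖ ^ n)
    -- the root-regime tail (LH4-p19 (g3)'s R1a spelling)
    (hμρ : ρ (lam - jE ((u : Matrix (Fin 1) (Fin 1) E) 0 0)) ≠ lam - jE ((u : Matrix (Fin 1) (Fin 1) E) 0 0))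
    {κ₀ ξ₀ : M} {V W BE P γ₁ W₁ : E} (hσV : σ V = V)
    (hκ : (cc * (α - ρ α) * Θ (dualGen ρ Θ α cc hM x₀))⁻¹ * (jE (pairing σ H₂ w₀ w₀))⁻¹ = κ₀ + jE V * ξ₀)
    (hWc : jE W * ξ₀ = ρ (lam - jE ((u : Matrix (Fin 1) (Fin 1) E) 0 0)) / (ρ (lam - jE ((u : Matrix (Fin 1) (Fin 1) E) 0 0)) - (lam - jE ((u : Matrix (Fin 1) (Fin 1) E) 0 0))) - κ₀)
    (hBE : jE BE = ((lam - jE ((u : Matrix (Fin 1) (Fin 1) E) 0 0)) - ρ (lam - jE ((u : Matrix (Fin 1) (Fin 1) E) 0 0))) * ξ₀)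
    (hP0 : P ≠ 0) (hσP : σ P = P) (hσpw : σ (pairing σ H₂ w₀ w₀) = pairing σ H₂ w₀ w₀) (hpwP : Valued.v (pairing σ H₂ w₀ w₀ * P) = 1)
    (hσγ : σ γ₁ = γ₁) (hσW₁ : σ W₁ = W₁)
    (hθ : Valued.v (BE / (P * ((ϖ - σ ϖ) * ((ϖ * σ ϖ) ^ ((d - d % 2) / 2))⁻¹)) - γ₁) ≤ Valued.v γ₁ * Valued.v ϖ ^ (2 * d - 1))
    (hWW : Valued.v (γ₁ * (W - W₁)) ≤ Valued.v ϖ ^ (2 * d - 1)) :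
    ({z : E | ∃ y ∈ L, Valued.v ((ϖ ^ mstarOfRecord d)⁻¹ * (z - pairing σ (!![H₂ 0 0, 0, H₂ 0 1; 0, h, 0; H₂ 1 0, 0, H₂ 1 1] : Matrix (Fin 3) (Fin 3) E) y
          ((((endoGL (γ₂, u) : GL (Fin 3) E) : Matrix (Fin 3) (Fin 3) E) - 1) *ᵥ y))) ≤ 1} =
        valueSetMod σ ϖ (mstarOfRecord d) (xPlus σ ϖ d)) ↔
      normSign σ (pairing σ H₂ w₀ w₀ * P) * normSign σ (γ₁ * (V - W₁)) = 1 := by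
  classical
  obtain ⟨hσσ, hvσ, hϖ, -, hd, hd1, -⟩ := id hD
  haveI := isAdicComplete_valuedInteger_of_completeSpace (K := E) hϖ
  have hvϖ0 : Valued.v ϖ ≠ 0 := by rw [hϖ]; exact exp_ne_zero
  have hϖlt : Valued.v ϖ < 1 := by rw [hϖ, ← exp_zero, exp_lt_exp]; norm_num
  have hρj : ∀ c : E, ρ (jE c) = jE c := fun c => (hjfix _).2 ⟨c, rfl⟩
  have hsmall : Valued.v ϖ ^ (2 * d - 1) < 1 := pow_lt_one₀ zero_le hϖlt (by omega)
  set D₀ : M := cc * (α - ρ α) * Θ (dualGen ρ Θ α cc hM x₀) with hD₀def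
  set pw : E := pairing σ H₂ w₀ w₀ with hpwdef
  set tp : E := (ϖ - σ ϖ) * ((ϖ * σ ϖ) ^ ((d - d % 2) / 2))⁻¹ with htpdef
  set μ : M := lam - jE ((u : Matrix (Fin 1) (Fin 1) E) 0 0) with hμdef
  -- the glue letter, the ray scalar and its root form
  have hTr : D₀⁻¹ + ρ D₀⁻¹ = jE pw := inv_add_map_inv_eq_map_pairing σ H₂ jE hΘΘ φ hhM hform hcc hx₀ hw₀Y
  have hpw0 : pw ≠ 0 := fun h0 => by rw [h0, zero_mul, Valuation.map_zero] at hpwP; exact zero_ne_one hpwP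
  obtain ⟨e₀, he₀⟩ : ∃ e₀ : E, jE e₀ = μ / D₀ + ρ (μ / D₀) := (hjfix _).1 (by rw [map_add, hρρ, add_comm])
  have he : e₀ = pw * BE * (V - W) := by
    apply jE.injective
    rw [he₀, trace_div_cellScalar_eq_root jE hρj hρρ hTr hpw0 hκ hμρ hWc, map_mul, map_mul, hBE, map_sub]
  -- strict forms of the two letters, and the sphere (§1)
  have hγ0 : γ₁ ≠ 0 := by
    intro h0
    rw [h0, sub_zero, Valuation.map_zero, zero_mul] at hθ
    have hBE0 : BE / (P * tp) = 0 := (Valuation.zero_iff _).1 (le_antisymm hθ zero_le)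
    -- then `e₀ = 0`, contradicting `|e₀| = |ϖ|^{ℓ₀}`
    have htp : Valued.v tp = Valued.v ϖ ^ (d % 2) := v_refSkew_eq hvσ hϖ hd
    have htp0 : tp ≠ 0 := fun h0' => by rw [h0', map_zero] at htp; exact pow_ne_zero _ hvϖ0 htp.symm
    have hBE' : BE = 0 := by
      rcases div_eq_zero_iff.1 hBE0 with h' | h'
      · exact h'
      · exact absurd h' (mul_ne_zero hP0 htp0)
    have he₀v : Valued.v e₀ = Valued.v ϖ ^ (d % 2) := v_rayScalar_eq_of_line hρρ hvρ hα hα1 hΘρ hvΘ jE hjv hϖ hc hc0 hYO hYb hcb (d % 2) hμle hanti he₀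
    rw [he, hBE', mul_zero, zero_mul, Valuation.map_zero] at he₀v
    exact pow_ne_zero _ hvϖ0 he₀v.symm
  have hγpos : (0 : ℤᵐ⁰) < Valued.v γ₁ := zero_lt_iff.2 ((Valuation.ne_zero_iff _).2 hγ0)
  have hθlt : Valued.v (BE / (P * tp) - γ₁) < Valued.v γ₁ :=
    hθ.trans_lt (by calc Valued.v γ₁ * Valued.v ϖ ^ (2 * d - 1) < Valued.v γ₁ * 1 := mul_lt_mul_of_pos_left hsmall hγpos
      _ = Valued.v γ₁ := mul_one _)
  have hWlt : Valued.v (γ₁ * (W - W₁)) < 1 := hWW.trans_lt hsmall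
  have hsph : Valued.v (γ₁ * (V - W₁)) = 1 :=
    sphere_of_line hvσ hϖ hd H₂ jE hjv hjfix hρρ hvρ hα hα1 hΘΘ hΘρ hvΘ φ hhM hform hc hc0 hcc hx₀ hw₀Y hYO hYb hcb hμle hanti he₀ hμρ hκ hWc hBE hP0 hpwP hθlt hWlt
  -- ★ p863761: the vertex is the fixed-unit ray `e′ • X₊` (no ray domination)
  obtain ⟨e', he'σ, he'1, hclose, hVS⟩ := exists_fixed_unit_valueSet_eq_smul_xPlus_of_line_sizes_A hD H₂ h jE hjv hjiso hjfix hρρ hvρ hα hα1 hΘΘ hΘρ hvΘ hΘj hU hτ h2v φ hφs hφγ hhM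
    hΘh hform hpr hint hB hg₀ hg₀1 hprg u hc hc0 hc1 hcc hx₀ hBΛ hΛx hw₀Y hYO hYb hcb hμle hanti g1 g2b g2c g3 hn gsk hΘlam hvlam huu he₀ hlamn hun
  rw [hVS]
  have hbit : valueSetMod σ ϖ (mstarOfRecord d) (e' • xPlus σ ϖ d) = valueSetMod σ ϖ (mstarOfRecord d) (xPlus σ ϖ d) ↔ ∃ z : E, z * σ z = e' :=
    labelPlus_smul_xPlus_iff_exists_norm hD he'σ he'1
  rw [hbit]
  -- the root-regime dictionary at `T := pw·P`, `θ := BE∕(P·t₊)`, `f := e′`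
  have htp : Valued.v tp = Valued.v ϖ ^ (d % 2) := v_refSkew_eq hvσ hϖ hd
  have htp0 : tp ≠ 0 := fun h0 => by rw [h0, map_zero] at htp; exact pow_ne_zero _ hvϖ0 htp.symm
  have hσT : σ (pw * P) = pw * P := by rw [map_mul, hσpw, hσP]
  have hnear : Valued.v (pw * P * (BE / (P * tp) * (V - W)) - e') ≤ Valued.v ϖ ^ (2 * d - 1) := by
    have hm : mstarOfRecord d = d % 2 + (2 * d - 1) := by rw [show mstarOfRecord d = d % 2 + 2 * d - 1 from rfl]; omega
    have e1 : pw * P * (BE / (P * tp) * (V - W)) - e' = tp⁻¹ * (e₀ - e' * tp) := by rw [he]; field_simp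
    have htppos : (0 : ℤᵐ⁰) < Valued.v tp := zero_lt_iff.2 ((Valuation.ne_zero_iff _).2 htp0)
    rw [e1, Valuation.map_mul, map_inv₀, htp, ← div_eq_inv_mul, div_le_iff₀ (by rw [← htp]; exact htppos), ← pow_add, add_comm, ← hm]
    exact hclose
  have hns := normSign_eq_mul_of_rootRegime hD hσγ hσW₁ hσT hpwP hσV he'σ hθ hWW hsph hnear
  constructor
  · intro hz
    have h1 : normSign σ e' = 1 := by rw [normSign, if_pos hz]
    rw [← h1, hns]
  · intro h1
    rw [← hns] at h1
    by_contra hz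
    rw [normSign, if_neg hz] at h1
    exact absurd h1 (by norm_num)

end Summit.HodgeConjecture.HodgeConjecture.Cruxes.H413.F0P3cDyRamLowerLineVertexReadsA

end
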